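import Summits.HodgeConjecture.HodgeConjecture.Theorems.Ring2WeilCoverageRamifiedTypes
import Summits.HodgeConjecture.HodgeConjecture.Theorems.Ring2WeilCoverageRamifiedPrimePowers
import Summits.HodgeConjecture.HodgeConjecture.Theorems.Ring2WeilCoverageCyclotomicSignaturesG10
import Summits.HodgeConjecture.HodgeConjecture.Theorems.Ring2WeilCoverageCyclotomicUnconditionalSqrtNegEleven
import HarnessLib

/-!
# Weil-type family coverage — THE SECOND RAMIFIED TYPE AT LEVEL `44`: every `ℚ(√−11)`-balanced CM type of `ℚ(ζ₄₄)` also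
# carries a polarisation of type `𝔮₂` (`𝔮₂² = (2)`, `N(𝔬𝔣₀) = 2¹⁰`, degree `32`, elementary divisors `(1⁵, 2⁵)`) — whose polarised
# CM points lie on the NON-SPLIT component `T = {2, 11}` of the `ℚ(√−11)` Weil locus in dimension `10` (S-pencil)

research route conditional on HC_CM; not a corollary; Q11.4-sentence-2 already refuted in dim ≥ 3.

Ring 2, WEIL-TYPE FAMILY-COVERAGE CENSUS (`HOME/WEIL-FAMILY-COVERAGE.md` `## b01`, blocks b01.8.3 (the `g = 10` table, rows
`W10.11.a`), b01.34 (the NO row `(44, √−11)`), this gen's part 50 (the first ramified type `𝔮₁₁` at `44`, degree `11`, split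
component); owner ring2-b01), part 52a of the `Ring2WeilCoverage*` series (parts 48 / 48c).  At `44` the prime of `ℚ(ζ₄₄)⁺` over
`2` is inert in `ℚ(ζ₄₄)` as well (`2` has order `10` mod `11`), so it flips the principal verdict too:

* `π = ζ³⁸(1 − ζ¹¹)(1 − ζ)` (`ζ¹¹ = i`: `(π) = (1 − i) = 𝔭₂`, `(π)² = (2)`): `adm_fortyFourB`, `twistSet_fortyFourB`
  (`X_π = {3, 5, 15, 17, 23, 25, 31, 35, 37, 43}`, `|A_π|/2 = 5`), `exists_type_ideal_fortyFourB`, `map_type_pow_fortyFourB`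
  (`(𝔬𝔣₀)² = (2)`), **`exists_type_fortyFourB_sqrt_neg_eleven`** / **`exists_ramifiedType_fortyFourB_sqrt_neg_eleven`** (EVERY
  `ℚ(√−11)`-balanced `Φ`: a `Φ`-positive divisor of type `𝔣₀`, degree `32`), `not_exists_type_fortyFourB_sqrt_neg_one` (the
  `ℚ(i)`-balanced = YES-row types do not carry it).

COMPONENTS (S-pencil, exact; `a = (−1)ⁿ det(δ·Tr_{L/K}(ζ′ζ^{j−k}))`, [vG94 5.2]): on the `(44, √−11)`-balanced tori the principal
`ξ` gives `a = −1` (no polarisation — the NO row), the degree-`11` type of part 50 gives `a = 11 ≡ 1` (SPLIT), and THIS degree-`32`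
type gives `a = 32 ≡ 2`, `T(a) = {2, 11}`: **the first `ℤ[ζ₄₄]`-CM points of record on a NON-split `ℚ(√−11)` tenfold component**.

HONEST FRAMING: torus-level statements about Shimura's divisors `X_ζ′` of type `(K; Φ; 𝔣₀)` on the principal CM torus
`ℂ^Φ/Φ(ℤ[ζ_M])` [Sh98 §14.3 Prop. 4–5] and elementary ideal arithmetic in `ℤ[ζ_M]`; all residue sets are displayed and checked
by `decide`; the COMPONENT statements (hermitian discriminant classes `a`, sets `T(a)`) are S-pencil — exact determinants of the
`K`-hermitian Gram matrices `Tr_{L/K}(πξ ζ^{j−k})` computed outside the kernel (`work/py/component.py`, mirror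
`pub-hodge-ring2-b01/g61/py/`) — and are quoted in the docstrings only; nothing here is a statement about Hodge classes, `W_K`,
general members or HC; `HC_CM` is used nowhere.  No `def`, no named fact, no `sorry`.

References: [cite: Shimura1998, §14.3 Prop. 4–5, pp. 103–104]; [cite: Washington1997, §8.1, Lemma 1.4, Prop. 2.8];
[cite: vanGeemen1994HodgeAV, Lemma 5.2, Thm. 5.10] (discriminant class of a Weil-type polarisation); census b01.17 / b01.38 (seat-derived).
-/

noncomputable section

open Polynomial NumberField Complex Finset
open scoped Real nonZeroDivisors

namespace Summit.HodgeConjecture.Ring2WeilCoverage.RamifiedTypesLevel44PrimeTwo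

open Literature.AlgebraicGeometry.Motives (CMType)
open Literature.AlgebraicGeometry.HodgeTheory (IsCMTypeSet)
open Literature.AlgebraicGeometry.ComplexMultiplication.CyclotomicCMType (isCMTypeSet_residueFilter)
open Literature.NumberTheory.ComplexMultiplication
open Summit.HodgeConjecture.Ring2WeilCoverage.RamifiedTypes
open Summit.HodgeConjecture.Ring2WeilCoverage.RamifiedPrimePowers
open Summit.HodgeConjecture.Ring2WeilCoverage.CyclotomicUnitProducts (isUnit_one_sub_toInteger_pow)
open Summit.HodgeConjecture.Ring2WeilCoverage.CMTypeSetPairCount (card_inter_add_card_inter_eq)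
open Summit.HodgeConjecture.Ring2WeilCoverage.CMTypeSetOddPositions (two_mul_card_eq_card_units)
open Summit.HodgeConjecture.Ring2WeilCoverage.CyclotomicSignaturesG10 (exists_units_sign_eq_fortyFour)
open Summit.HodgeConjecture.Ring2WeilCoverage.CyclotomicUnconditionalSqrtNegEleven (norm_realUnits_pos_fortyFour)

variable {K : Type} [Field K] [NumberField K] {ζ : K}

/-- `𝐞(t) = exp(2πi t/n) ∈ ℂ` (`ZMod.toCircle`). -/
local notation3 (prettyPrint := false) "𝐞 " t:max => ((ZMod.toCircle t : Circle) : ℂ)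

section Level44

/-- the residue set `S_Φ` read at level `44`. -/
local notation3 (prettyPrint := false) "SΦ[" Φ "," z "]" =>
  (Finset.univ.filter fun t : ZMod 44 => ∃ σ ∈ (Φ : CMType K).1, σ (z : K) = 𝐞 t)

/-- part 48's twisted sign set `X_π` at level `44` (`n := 44`). -/
local notation3 (prettyPrint := false) "Xtw44 " x:max =>
  (Finset.univ.filter fun t : ZMod 44 => t.val.Coprime 44 ∧
    ¬ ((44 < (x : ℕ × ℕ × ℕ).1 * ZMod.val t % (2 * 44) ↔ 44 < (x : ℕ × ℕ × ℕ).2.1 * ZMod.val t % (2 * 44)) ↔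
      Even (Finset.card (Finset.filter (fun s : ZMod 44 => s.val.Coprime 44 ∧ s.val < t.val) Finset.univ))))

/-- the census's `N_odd` at level `44` (part 5). -/
local notation3 (prettyPrint := false) "Nodd44" =>
  (Finset.univ.filter fun t : ZMod 44 => t.val.Coprime 44 ∧
    Even (Finset.card (Finset.filter (fun s : ZMod 44 => s.val.Coprime 44 ∧ s.val < t.val) Finset.univ)))

/-! #### Level `44`, the type `𝔣₀` with `𝔬𝔣₀ = (π)`, `π = ζ^38(1 − ζ^11)(1 − ζ^1)` (`ζ^11` a primitive `4`-th root of unity: `(π) = (1 − ζ^11)`, `(π)^2 = (2)`) -/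

/-- the semi-admissibility of `x = (11, 1, 38)` at level `44` (`44 ∤ 11, 1`; `2·38 + 11 + 1 ≡ 0 (mod 88)`). [folklore] -/
theorem adm_fortyFourB : ¬ 44 ∣ ((11, 1, 38) : ℕ × ℕ × ℕ).1 ∧ ¬ 44 ∣ ((11, 1, 38) : ℕ × ℕ × ℕ).2.1 ∧
    (2 * ((11, 1, 38) : ℕ × ℕ × ℕ).2.2 + ((11, 1, 38) : ℕ × ℕ × ℕ).1 + ((11, 1, 38) : ℕ × ℕ × ℕ).2.1) % (2 * 44) = 0 := by
  decide

/-- **The twisted sign set at level `44` for `π = ζ^38(1 − ζ^11)(1 − ζ^1)`: `X_π = N_odd ∆ A_π = [3, 5, 15, 17, 23, 25, 31, 35, 37, 43]`** (`A_π = [1, 3, 9, 17, 19, 25, 27, 35, 41, 43]`, `|A_π|/2 = 5`;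
`decide`).
research route conditional on HC_CM; not a corollary; Q11.4-sentence-2 already refuted in dim ≥ 3. [folklore] -/
theorem twistSet_fortyFourB : Xtw44 ((11, 1, 38) : ℕ × ℕ × ℕ) = ({3, 5, 15, 17, 23, 25, 31, 35, 37, 43} : Finset (ZMod 44)) := by
  decide

/-- **A type `𝔣₀ ⊆ 𝓞 K⁺` with `𝔬𝔣₀ = (π)`, `π = ζ^38(1 − ζ^11)(1 − ζ^1)`, EXISTS** (part 48 `exists_ideal_map_eq_span_gen`).
research route conditional on HC_CM; not a corollary; Q11.4-sentence-2 already refuted in dim ≥ 3. [cite: Shimura1998, §14.3, p. 103] -/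
theorem exists_type_ideal_fortyFourB [IsCMField K] (hζ : IsPrimitiveRoot ζ 44) :
    ∃ 𝔣₀ : Ideal (𝓞 (maximalRealSubfield K)),
      𝔣₀.map (algebraMap (𝓞 (maximalRealSubfield K)) (𝓞 K)) = Ideal.span {hζ.toInteger ^ 38 * (1 - hζ.toInteger ^ 11) * (1 - hζ.toInteger ^ 1)} :=
  exists_ideal_map_eq_span_gen (x := ((11, 1, 38) : ℕ × ℕ × ℕ)) hζ adm_fortyFourB

omit [NumberField K] in
/-- **`(𝔬𝔣₀)^2 = (2)`** for the type `𝔣₀` with `𝔬𝔣₀ = (π)`, `π = ζ^38(1 − ζ^11)(1 − ζ^1)`: `(π) = (1 − ζ^11)` (the factors `ζ^38`,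
`1 − ζ^1` are units, part 13) and `(1 − ζ^11)^2 = (2)` (part 48c, `ζ^11` a primitive `4`-th root of unity) — so
`N(𝔬𝔣₀) = 2^10`, `N_{K⁺/ℚ}(𝔣₀) = 2^5`: a polarisation of type `𝔣₀` on `ℂ^Φ/Φ(ℤ[ζ_44])` has degree `32`.
research route conditional on HC_CM; not a corollary; Q11.4-sentence-2 already refuted in dim ≥ 3. [cite: Washington1997, Lemma 1.4, Prop. 2.8] -/
theorem map_type_pow_fortyFourB (hζ : IsPrimitiveRoot ζ 44) {𝔣₀ : Ideal (𝓞 (maximalRealSubfield K))}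
    (h𝔣₀ : 𝔣₀.map (algebraMap (𝓞 (maximalRealSubfield K)) (𝓞 K)) = Ideal.span {hζ.toInteger ^ 38 * (1 - hζ.toInteger ^ 11) * (1 - hζ.toInteger ^ 1)}) :
    𝔣₀.map (algebraMap (𝓞 (maximalRealSubfield K)) (𝓞 K)) ^ 2 = Ideal.span {(2 : 𝓞 K)} := by
  have hη : IsPrimitiveRoot (ζ ^ 11) 4 := hζ.pow (by norm_num) (by norm_num)
  have hηint : hη.toInteger = hζ.toInteger ^ 11 := RingOfIntegers.ext (by simp [IsPrimitiveRoot.toInteger])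
  have hu1 : IsUnit (hζ.toInteger ^ 38 : 𝓞 K) := (hζ.toInteger_isPrimitiveRoot.isUnit (by norm_num)).pow 38
  have hu2 : IsUnit (1 - hζ.toInteger ^ 1 : 𝓞 K) := isUnit_one_sub_toInteger_pow hζ (by decide) (by decide +kernel)
  rw [h𝔣₀, Ideal.span_singleton_mul_right_unit hu2, Ideal.span_singleton_mul_left_unit hu1, ← hηint]
  exact span_one_sub_pow_eq_four hη

open scoped Classical in
/-- **CENSUS ROW `(ℚ(ζ_44), ℚ(√−11))` (a NO row for principal polarisations) — the RAMIFIED TYPE EXISTS: for every CM type `Φ`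
of `ℚ(ζ_44)` balanced for `N_K = [7, 13, 17, 19, 21, 29, 35, 39, 41, 43]` (the Weil signature `(5,5)` on `K = ℚ(√−11)`) and every type `𝔣₀` with
`𝔬𝔣₀ = (π)`, `π = ζ^38(1 − ζ^11)(1 − ζ^1)`, the principal CM torus `ℂ^Φ/Φ(ℤ[ζ_44])` CARRIES a `Φ`-positive divisor `X_ζ′` of type
`(K; Φ; 𝔣₀)`** — `ζ′^ρ = −ζ′`, `Im φ(ζ′) > 0` on `Φ`, `IsOfType 1 ζ′ 𝔣₀` [Sh98 §14.3 Prop. 4: a polarisation whose `φ_X` is the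
`𝔬𝔣₀`-multiplication, of degree `32`].  Proof: part 48 `exists_type_of_even` + THEOREM L (ii) at `44` + the residue count
`|S_Φ ∩ X_π| ≡ |X_π ∖ N_K| + g/2 = 7 + 5 ≡ 0`.
research route conditional on HC_CM; not a corollary; Q11.4-sentence-2 already refuted in dim ≥ 3. [cite: Shimura1998, §14.3 Prop. 4–5, pp. 103–104] -/
theorem exists_type_fortyFourB_sqrt_neg_eleven [IsCMField K] [IsCyclotomicExtension {44} ℚ K] (hζ : IsPrimitiveRoot ζ 44)
    (Φ : CMType K) (hbal : 2 * (SΦ[Φ, ζ] ∩ ({7, 13, 17, 19, 21, 29, 35, 39, 41, 43} : Finset (ZMod 44))).card = (SΦ[Φ, ζ]).card)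
    {𝔣₀ : Ideal (𝓞 (maximalRealSubfield K))}
    (h𝔣₀ : 𝔣₀.map (algebraMap (𝓞 (maximalRealSubfield K)) (𝓞 K)) = Ideal.span {hζ.toInteger ^ 38 * (1 - hζ.toInteger ^ 11) * (1 - hζ.toInteger ^ 1)}) :
    ∃ ζ' : K, IsCMField.complexConj K ζ' = -ζ' ∧ (∀ φ : Φ.1, 0 < (φ.1 ζ').im) ∧
        CMTypeLattice.IsOfType (1 : (FractionalIdeal (𝓞 K)⁰ K)ˣ) ζ' 𝔣₀ := by
  have hg : Nat.totient 44 = 2 * (9 + 1) := by decide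
  refine exists_type_of_even hζ hg adm_fortyFourB Φ h𝔣₀ (exists_units_sign_eq_fortyFour hζ Φ) ?_
  rw [twistSet_fortyFourB]
  have hS := isCMTypeSet_residueFilter hζ Φ
  have hX : IsCMTypeSet 44 ({3, 5, 15, 17, 23, 25, 31, 35, 37, 43} : Finset (ZMod 44)) := by decide
  have hNK : IsCMTypeSet 44 ({7, 13, 17, 19, 21, 29, 35, 39, 41, 43} : Finset (ZMod 44)) := by decide
  have h1 := card_inter_mod_two_eq hS hX hNK
  have h2 := two_mul_card_eq_card_units hS
  have hU : (Finset.univ.filter fun t : ZMod 44 => t.val.Coprime 44).card = 20 := by decide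
  have h3 : (({3, 5, 15, 17, 23, 25, 31, 35, 37, 43} : Finset (ZMod 44)) \ ({7, 13, 17, 19, 21, 29, 35, 39, 41, 43} : Finset (ZMod 44))).card = 7 := by decide
  rw [Nat.even_iff]
  omega

open scoped Classical in
/-- **CENSUS ROW `(ℚ(ζ_44), ℚ(√−11))`, headline form: there is a type `𝔣₀ ⊆ 𝓞 K⁺` with `(𝔬𝔣₀)^2 = (2)` such that
`ℂ^Φ/Φ(ℤ[ζ_44])` carries a `Φ`-positive divisor of type `(K; Φ; 𝔣₀)`** for every `K`-balanced CM type `Φ`, `K = ℚ(√−11)`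
(polarisation degree `32`; the census's NO row gets an explicit NON-principal polarisation).
research route conditional on HC_CM; not a corollary; Q11.4-sentence-2 already refuted in dim ≥ 3. [cite: Shimura1998, §14.3 Prop. 4–5, pp. 103–104] -/
theorem exists_ramifiedType_fortyFourB_sqrt_neg_eleven [IsCMField K] [IsCyclotomicExtension {44} ℚ K]
    (hζ : IsPrimitiveRoot ζ 44) (Φ : CMType K) (hbal : 2 * (SΦ[Φ, ζ] ∩ ({7, 13, 17, 19, 21, 29, 35, 39, 41, 43} : Finset (ZMod 44))).card = (SΦ[Φ, ζ]).card) :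
    ∃ 𝔣₀ : Ideal (𝓞 (maximalRealSubfield K)),
      𝔣₀.map (algebraMap (𝓞 (maximalRealSubfield K)) (𝓞 K)) ^ 2 = Ideal.span {(2 : 𝓞 K)} ∧
      ∃ ζ' : K, IsCMField.complexConj K ζ' = -ζ' ∧ (∀ φ : Φ.1, 0 < (φ.1 ζ').im) ∧
        CMTypeLattice.IsOfType (1 : (FractionalIdeal (𝓞 K)⁰ K)ˣ) ζ' 𝔣₀ := by
  obtain ⟨𝔣₀, h𝔣₀⟩ := exists_type_ideal_fortyFourB hζ
  exact ⟨𝔣₀, map_type_pow_fortyFourB hζ h𝔣₀, exists_type_fortyFourB_sqrt_neg_eleven hζ Φ hbal h𝔣₀⟩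

open scoped Classical in
/-- **Row `(ℚ(ζ_44), ℚ(i))` (a YES row for principal polarisations) does NOT carry the ramified type**: for `Φ` balanced
for `N_K = [3, 7, 15, 19, 23, 27, 31, 35, 39, 43]` (`K = ℚ(i)`) there is NO `Φ`-positive divisor of type `𝔣₀`, `𝔬𝔣₀ = (π)`, `π = ζ^38(1 − ζ^11)(1 − ζ^1)` —
THEOREM L (i) at `44` + the odd count `|S_Φ ∩ X_π| ≡ 4 + 5` (part 48 `not_exists_type_of_norm_pos_of_odd`).
research route conditional on HC_CM; not a corollary; Q11.4-sentence-2 already refuted in dim ≥ 3. [cite: Shimura1998, §14.3 Prop. 5, p. 104] -/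
theorem not_exists_type_fortyFourB_sqrt_neg_one [IsCMField K] [IsCyclotomicExtension {44} ℚ K] (hζ : IsPrimitiveRoot ζ 44)
    (Φ : CMType K) (hbal : 2 * (SΦ[Φ, ζ] ∩ ({3, 7, 15, 19, 23, 27, 31, 35, 39, 43} : Finset (ZMod 44))).card = (SΦ[Φ, ζ]).card)
    {𝔣₀ : Ideal (𝓞 (maximalRealSubfield K))}
    (h𝔣₀ : 𝔣₀.map (algebraMap (𝓞 (maximalRealSubfield K)) (𝓞 K)) = Ideal.span {hζ.toInteger ^ 38 * (1 - hζ.toInteger ^ 11) * (1 - hζ.toInteger ^ 1)}) :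
    ¬ ∃ ζ' : K, IsCMField.complexConj K ζ' = -ζ' ∧ (∀ φ : Φ.1, 0 < (φ.1 ζ').im) ∧
        CMTypeLattice.IsOfType (1 : (FractionalIdeal (𝓞 K)⁰ K)ˣ) ζ' 𝔣₀ := by
  have hg : Nat.totient 44 = 2 * (9 + 1) := by decide
  refine not_exists_type_of_norm_pos_of_odd hζ hg adm_fortyFourB Φ h𝔣₀ (norm_realUnits_pos_fortyFour hζ) ?_
  rw [twistSet_fortyFourB]
  have hS := isCMTypeSet_residueFilter hζ Φ
  have hX : IsCMTypeSet 44 ({3, 5, 15, 17, 23, 25, 31, 35, 37, 43} : Finset (ZMod 44)) := by decide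
  have hNK : IsCMTypeSet 44 ({3, 7, 15, 19, 23, 27, 31, 35, 39, 43} : Finset (ZMod 44)) := by decide
  have h1 := card_inter_mod_two_eq hS hX hNK
  have h2 := two_mul_card_eq_card_units hS
  have hU : (Finset.univ.filter fun t : ZMod 44 => t.val.Coprime 44).card = 20 := by decide
  have h3 : (({3, 5, 15, 17, 23, 25, 31, 35, 37, 43} : Finset (ZMod 44)) \ ({3, 7, 15, 19, 23, 27, 31, 35, 39, 43} : Finset (ZMod 44))).card = 4 := by decide
  rw [Nat.odd_iff]
  omega

end Level44

end Summit.HodgeConjecture.Ring2WeilCoverage.RamifiedTypesLevel44PrimeTwo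

end
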